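import Literature.Combinatorics.SimpleGraph.TreeDisplacementLayerCount   -- ★ `TreeDisplacement.exists_height_parent`, `ncard_displaced_succ_inter_type_eq`, `finite_setOf_dist_self_apply_eq`
import HarnessLib

/-!
# R90 · S6 «Ch. 14.1–14.5 stable TF» — WAVE 8 card W8-f: THE DISPLACEMENT SPHERE COUNT of an elliptic tree automorphism, CLOSED FORM
# `#{x : d(x, γx) = 2k, type i} = q_j^{⌊k∕2⌋} q_i^{⌊(k−1)∕2⌋} · #{x : d(x, γx) = 2, type i₀}` and `#{x : d(x, γx) = 2, type i} = Σ_{y ∈ Fix γ, type j} #(N(y) ∖ Fix γ)`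
# (`Theorems/R90S6TreeDisplacementSphereCount.lean`)

Cell `hodgecm-mathlib`, crux H413 (`stmt-HodgeConjecture-24833`), route `HCCMUnconditional`; programme R90-TF, section S6 (base `R90-C14`, dealer R90-C14-plan (g2)), seat
R90-C14-p10 (g0); card **W8-f** «DISPLACEMENT SPHERE COUNT» (DEAL 23:39:09Z l.5126; DAG r5 row E1.3.5.2.3, second half: «the count `Σ_x` over the displacement spheres
`{x | d(x, γx) = 2k}`», first half = ★ W6-a `dist_map_eq_two_mul_of_nearest_fixed` + ★ W6-c `fixedPoints_convex_of_isTree`).  Lane `--kind proof --supports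
stmt-HodgeConjecture-24833` (helper; generic graph theory, THEOREMS ONLY: no definition, no instance, no notation, no named fact, no `sorry`; one PRIVATE bookkeeping lemma).
Imports: ★ `Literature.Combinatorics.SimpleGraph.TreeDisplacementLayerCount` (F0P3a-p08's «tree organs»: retraction data onto `Fix α` with `d(v, αv) = 2·h(v)`, the typed shell
RECURSION `#{d = 2(k+1), type i} = q_j · #{d = 2k, type j}` for `k ≥ 1`, finiteness of the shells) + HarnessLib; no `Cruxes` import.

CENSUS (dealer's order «if the count is ★ post “already ★”»): the RECURSION is ★ (`TreeDisplacement.ncard_displaced_succ_inter_type_eq`, its per-period twin, and the `ncard`-valency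
wrappers), the typed FIRST LAYER above a subtree is ★ in height currency (`TreeLayers.ncard_layer_one_inter_type_eq_sum_of_hereditary`), and the spheres ABOUT ONE VERTEX are ★ in closed
form (`TreeLayers.ncard_sphere_eq_of_biregular`, W6-b∕b′ p863110∕p863133).  NOT ★ before this file: (a) the FIRST DISPLACEMENT SHELL `#{d(x, γx) = 2}` as the boundary count of
`Fix γ` in displacement currency, (b) the CLOSED FORM of the `k`-th displacement shell (the recursion solved from the first shell), (c) the untyped closed form on a REGULAR tree.  These
are the three sections below; the automorphic reading (`O_γ(𝟙_{K₀ tᵏ K₀}) ∝ #{x hyperspecial : d(x, γx) = 2k}` via ★ W8-d and ★ `OrbitalIntegralDoubleCosetUnfolding`, which unfolds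
EVERY `K`-conjugation-invariant `f`, not only `𝟙_K`) is the consumer's (E1.3.5.2.1∕.2.3), not restated here.

THE MATHEMATICS (Serre, *Trees* I.2.3 Ex. 2, I.6.4 Prop. 24; the «`(q+1)q^{k−1}`» count of the rank-one fundamental lemma, Langlands–Labesse 1979 §§2–3 ∕ Kottwitz 1980 for its use).
`G` a locally finite tree, `α : G ≃g G` with FINITE NON-EMPTY fixed set `F` (the elliptic case), `c : V → Fin 2` a type function (adjacent vertices have different types), every MOVED
vertex of type `t` of degree `q t + 1` ((`q³+1`, `q+1`) for the tree of `U(3)_w`, hyperspecial ∕ type-two).  By ★ W6-a∕`exists_height_parent`, `d(x, αx) = 2·d(x, F)`, so the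
displacement shell `{d(x, αx) = 2k}` is the `k`-th layer of the retraction onto `F`:
* §1 **`ncard_displaced_two_inter_type_eq_sum`**: `#{x : d(x, αx) = 2 ∧ c x = i} = Σ_{y ∈ F, c y = j} #{w ∈ N(y) : αw ≠ w}` (the first layer = the moved neighbours of the fixed
  vertices of the other type), and the untyped **`ncard_displaced_two_eq_sum`**: `#{x : d(x, αx) = 2} = Σ_{y ∈ F} #{w ∈ N(y) : αw ≠ w}`;
* §2 the recursion solved — **`ncard_displaced_inter_type_eq_of_odd`**: `#{d = 2(2m+1), type i} = (q_j q_i)^m · #{d = 2, type i}` and **`ncard_displaced_inter_type_eq_of_even`**: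
  `#{d = 2(2m+2), type i} = q_j (q_i q_j)^m · #{d = 2, type j}` (`i ≠ j`, all `m ∈ ℕ`; compare ★ `ncard_sphere_eq_of_biregular`'s `(q_a+1) q_b^{⌊n∕2⌋} q_a^{⌊(n−1)∕2⌋}`, the case
  `F = {x₀}`);
* §3 REGULAR trees (`q₀ = q₁ = q`: `SL₂`, `U(2)_w`) — **`ncard_displaced_eq_of_regular`**: `#{x : d(x, αx) = 2k} = q^{k−1} · #{x : d(x, αx) = 2}` (`k ≥ 1`), and with §1
  **`ncard_displaced_eq_of_regular_sum`**: `= q^{k−1} · Σ_{y ∈ F} #{w ∈ N(y) : αw ≠ w}` — for `F = {x₀}` this is the classical `(q+1) q^{k−1}`.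
WHY ON PATH: E1.3.5.2.3∕.2.4 (DAG r5) read the elliptic orbital integrals of the Hecke basis `𝟙_{K₀ t_k K₀}` as these counts, with `F = Fix γ` a ball whose boundary data
`Σ_{y ∈ F} #(N(y) ∖ F)` the torus-type tables (★ unit estate, `k = 0`) supply; this file turns boundary data into ALL shells, by name, for any tree.
HONEST LABEL: generic graph theory; proves no printed global statement, discharges no citation; count-neutral helper until E1.3.5.2 ∕ E1.3.9 consume it.  HC_CM is proved only
modulo the 7 printed citations (2 remaining named inputs: hLiu418 = stmt-HodgeConjecture-24832, h413 = stmt-HodgeConjecture-24833) until rung 0 closes.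

## References
* [Serre1980Trees] J.-P. Serre, *Trees* (1980), Ch. I §2.3 (projection onto a subtree; Ex. 2: spheres of a regular tree), §6.4 Prop. 24 (`d(x, γx) = 2 d(x, Fix γ)`), Ch. II §1.1.
* [Diestel2010] R. Diestel, *Graph Theory*, 4th ed. (2010), Thm. 1.5.1, §1.3 (trees, layers of a rooted tree).
-/
set_option autoImplicit false
-- the mandated namespace repeats the single-problem summit's segment (`HodgeConjecture.HodgeConjecture`)
set_option linter.dupNamespace false

open SimpleGraph
open Literature.Combinatorics.SimpleGraph

namespace Summit.HodgeConjecture.HodgeConjecture.R90.S6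

variable {V : Type*} {G : SimpleGraph V}

/-! ## §1 The first displacement shell is the moved boundary of `Fix α` -/

/-- **THE FIRST DISPLACEMENT SHELL, TYPED**: on a locally finite tree with an automorphism `α` whose fixed set `F` is finite and non-empty, and a type function `c` (adjacent
vertices of different types), for `i ≠ j`: `#{x | d(x, αx) = 2 ∧ c x = i} = Σ_{y ∈ F, c y = j} #{w ∈ N(y) | αw ≠ w}` — the moved vertices at distance one from `F` of type `i`
are the moved neighbours of the fixed vertices of type `j`, each counted once (its unique fixed neighbour; `F` is convex, ★ W6-c).  Proof: ★ `TreeDisplacement.exists_height_parent`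
(`d(x, αx) = 2·h(x)`) + ★ `TreeLayers.ncard_layer_one_inter_type_eq_sum_of_hereditary` with the trivial predicate. [cite: Serre1980Trees, I.2.3, I.6.4 Prop. 24] -/
theorem ncard_displaced_two_inter_type_eq_sum [DecidableEq V] [G.LocallyFinite] (hT : G.IsTree) (α : G ≃g G) {u : V} (hu : α u = u)
    (hfin : {v | α v = v}.Finite) (c : V → Fin 2) (hc : ∀ v w, G.Adj v w → c v ≠ c w) {i j : Fin 2} (hij : i ≠ j) :
    {x | G.dist x (α x) = 2 ∧ c x = i}.ncard =
      ∑ y ∈ hfin.toFinset.filter (fun y => c y = j), ((G.neighborFinset y).filter (fun w => α w ≠ w)).card := by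
  classical
  obtain ⟨h, p, -, h0, hpar, hchild, -, hdisp⟩ := TreeDisplacement.exists_height_parent hT α hu
  have h0' : ∀ v, h v = 0 ↔ v ∈ ({y | α y = y} : Set V) := h0
  have hP : ∀ w, w ∉ ({y | α y = y} : Set V) → ((fun _ : V => True) w ↔ (fun _ : V => True) (p w)) := fun _ _ => Iff.rfl
  have hD : {v | v ∈ ({y | α y = y} : Set V) ∧ (fun _ : V => True) v}.Finite := hfin.subset fun v hv => hv.1
  have key := TreeLayers.ncard_layer_one_inter_type_eq_sum_of_hereditary (Y := {y | α y = y}) (P := fun _ : V => True) h0'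
    (fun v hv => hpar v hv) (fun v w hv => hchild v w hv) hP hD c hc hij
  have e1 : {x | G.dist x (α x) = 2 ∧ c x = i} = {w | h w = 1 ∧ c w = i ∧ (fun _ : V => True) w} := by
    ext w
    simp only [Set.mem_setOf_eq, hdisp, and_true]
    constructor
    · rintro ⟨h1, h2⟩; exact ⟨by omega, h2⟩
    · rintro ⟨h1, h2⟩; exact ⟨by omega, h2⟩
  rw [e1, key]
  refine Finset.sum_congr ?_ fun y _ => ?_
  · ext y
    simp only [Finset.mem_filter, Set.Finite.mem_toFinset, Set.mem_setOf_eq, and_true]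
  · exact congrArg Finset.card (Finset.filter_congr fun w _ => Iff.rfl)

/-- **THE FIRST DISPLACEMENT SHELL (untyped)**: `#{x | d(x, αx) = 2} = Σ_{y ∈ F} #{w ∈ N(y) | αw ≠ w}` (locally finite tree, `F = Fix α` finite non-empty). [cite: Serre1980Trees, I.2.3, I.6.4 Prop. 24] -/
theorem ncard_displaced_two_eq_sum [DecidableEq V] [G.LocallyFinite] (hT : G.IsTree) (α : G ≃g G) {u : V} (hu : α u = u) (hfin : {v | α v = v}.Finite) :
    {x | G.dist x (α x) = 2}.ncard = ∑ y ∈ hfin.toFinset, ((G.neighborFinset y).filter (fun w => α w ≠ w)).card := by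
  classical
  obtain ⟨h, p, -, h0, hpar, hchild, -, hdisp⟩ := TreeDisplacement.exists_height_parent hT α hu
  have h0' : ∀ v, h v = 0 ↔ v ∈ ({y | α y = y} : Set V) := h0
  have hP : ∀ w, w ∉ ({y | α y = y} : Set V) → ((fun _ : V => True) w ↔ (fun _ : V => True) (p w)) := fun _ _ => Iff.rfl
  have hD : {v | v ∈ ({y | α y = y} : Set V) ∧ (fun _ : V => True) v}.Finite := hfin.subset fun v hv => hv.1
  have key := TreeLayers.ncard_layer_one_eq_sum_of_hereditary (Y := {y | α y = y}) (P := fun _ : V => True) h0'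
    (fun v hv => hpar v hv) (fun v w hv => hchild v w hv) hP hD
  have e1 : {x | G.dist x (α x) = 2} = {w | h w = 1 ∧ (fun _ : V => True) w} := by
    ext w
    simp only [Set.mem_setOf_eq, hdisp, and_true]
    omega
  rw [e1, key]
  refine Finset.sum_congr ?_ fun y _ => ?_
  · ext y
    simp only [Set.Finite.mem_toFinset, Set.mem_setOf_eq, and_true]
  · exact congrArg Finset.card (Finset.filter_congr fun w _ => Iff.rfl)

/-! ## §2 The displacement shells in closed form (the ★ recursion solved from the first shell) -/

/-- **CLOSED FORM, ODD LEVEL**: on a locally finite tree with `α : G ≃g G` of finite non-empty fixed set, a type function `c` (adjacent vertices of different types) and every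
MOVED vertex of type `t` of degree `q t + 1`, for `i ≠ j` and every `m`: `#{x | d(x, αx) = 2(2m+1) ∧ c x = i} = (q_j q_i)^m · #{x | d(x, αx) = 2 ∧ c x = i}` (two steps of ★
`TreeDisplacement.ncard_displaced_succ_inter_type_eq` per induction step). [cite: Serre1980Trees, I.2.3, I.6.4 Prop. 24] -/
theorem ncard_displaced_inter_type_eq_of_odd [G.LocallyFinite] (hT : G.IsTree) (α : G ≃g G) {u : V} (hu : α u = u) (hfin : {v | α v = v}.Finite)
    (c : V → Fin 2) (hc : ∀ v w, G.Adj v w → c v ≠ c w) (q : Fin 2 → ℕ) (hdeg : ∀ v, α v ≠ v → G.degree v = q (c v) + 1)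
    {i j : Fin 2} (hij : i ≠ j) (m : ℕ) :
    {x | G.dist x (α x) = 2 * (2 * m + 1) ∧ c x = i}.ncard = (q j * q i) ^ m * {x | G.dist x (α x) = 2 ∧ c x = i}.ncard := by
  induction m with
  | zero => simp
  | succ m ih =>
    have r1 := TreeDisplacement.ncard_displaced_succ_inter_type_eq hT α hu hfin c hc q hdeg hij (k := 2 * m + 2) (by omega)
    have r2 := TreeDisplacement.ncard_displaced_succ_inter_type_eq hT α hu hfin c hc q hdeg hij.symm (k := 2 * m + 1) (by omega)
    have e : 2 * (2 * (m + 1) + 1) = 2 * (2 * m + 2 + 1) := by ring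
    rw [e, r1, show 2 * m + 2 = 2 * m + 1 + 1 by ring, r2, ih, pow_succ]
    ring

/-- **CLOSED FORM, EVEN LEVEL**: same hypotheses; for `i ≠ j` and every `m`: `#{x | d(x, αx) = 2(2m+2) ∧ c x = i} = q_j (q_i q_j)^m · #{x | d(x, αx) = 2 ∧ c x = j}` — the
top type `i` is reached from the first-shell type `j` through `2m+1` alternating steps. [cite: Serre1980Trees, I.2.3, I.6.4 Prop. 24] -/
theorem ncard_displaced_inter_type_eq_of_even [G.LocallyFinite] (hT : G.IsTree) (α : G ≃g G) {u : V} (hu : α u = u) (hfin : {v | α v = v}.Finite)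
    (c : V → Fin 2) (hc : ∀ v w, G.Adj v w → c v ≠ c w) (q : Fin 2 → ℕ) (hdeg : ∀ v, α v ≠ v → G.degree v = q (c v) + 1)
    {i j : Fin 2} (hij : i ≠ j) (m : ℕ) :
    {x | G.dist x (α x) = 2 * (2 * m + 2) ∧ c x = i}.ncard = q j * (q i * q j) ^ m * {x | G.dist x (α x) = 2 ∧ c x = j}.ncard := by
  have r := TreeDisplacement.ncard_displaced_succ_inter_type_eq hT α hu hfin c hc q hdeg hij (k := 2 * m + 1) (by omega)
  rw [show 2 * m + 2 = 2 * m + 1 + 1 by ring, r, ncard_displaced_inter_type_eq_of_odd hT α hu hfin c hc q hdeg hij.symm m]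
  ring

/-! ## §3 Regular trees: `#{d(x, αx) = 2k} = q^{k−1} · #{d(x, αx) = 2}` -/

/-- Bookkeeping: a finite set splits along a `Fin 2`-valued function. [cite: Diestel2010, §1.3] -/
private theorem ncard_eq_ncard_add_ncard_of_fin_two {s : Set V} (hs : s.Finite) (c : V → Fin 2) :
    s.ncard = {w | w ∈ s ∧ c w = 0}.ncard + {w | w ∈ s ∧ c w = 1}.ncard := by
  have h01 : ∀ x : Fin 2, x = 0 ∨ x = 1 := by decide
  have hu : s = {w | w ∈ s ∧ c w = 0} ∪ {w | w ∈ s ∧ c w = 1} := by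
    ext w
    simp only [Set.mem_union, Set.mem_setOf_eq]
    constructor
    · intro hw
      rcases h01 (c w) with h | h
      · exact Or.inl ⟨hw, h⟩
      · exact Or.inr ⟨hw, h⟩
    · rintro (⟨hw, -⟩ | ⟨hw, -⟩) <;> exact hw
  have hdisj : Disjoint {w | w ∈ s ∧ c w = 0} {w | w ∈ s ∧ c w = 1} := by
    rw [Set.disjoint_left]
    rintro w ⟨-, h0⟩ ⟨-, h1⟩
    rw [h0] at h1
    exact absurd h1 (by decide)
  conv_lhs => rw [hu]
  exact Set.ncard_union_eq hdisj (hs.subset fun w hw => hw.1) (hs.subset fun w hw => hw.1)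

/-- **REGULAR TREES**: on a locally finite tree in which every MOVED vertex has degree `q + 1` (`SL₂(F)`, `U(2)_w`: `q = q_F`), for `α : G ≃g G` with finite non-empty fixed set and
`k ≥ 1`: `#{x | d(x, αx) = 2k} = q^{k−1} · #{x | d(x, αx) = 2}`.  Proof: split by the parity type about a fixed vertex (adjacent vertices have different parities, Mathlib
`IsTree.dist_eq_dist_add_one_of_adj`) and add the two closed forms of §2. [cite: Serre1980Trees, I.2.3 Ex. 2, I.6.4 Prop. 24] -/
theorem ncard_displaced_eq_of_regular [G.LocallyFinite] (hT : G.IsTree) (α : G ≃g G) {u : V} (hu : α u = u) (hfin : {v | α v = v}.Finite)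
    (q : ℕ) (hdeg : ∀ v, α v ≠ v → G.degree v = q + 1) {k : ℕ} (hk : 1 ≤ k) :
    {x | G.dist x (α x) = 2 * k}.ncard = q ^ (k - 1) * {x | G.dist x (α x) = 2}.ncard := by
  classical
  -- the parity type function about the fixed vertex `u`
  let c : V → Fin 2 := fun v => if Even (G.dist u v) then 0 else 1
  have hc : ∀ v w, G.Adj v w → c v ≠ c w := fun v w hadj => by
    simp only [c]
    rcases hT.dist_eq_dist_add_one_of_adj u hadj with h | h
    · rw [h]
      by_cases hw : Even (G.dist u w)
      · have hw' : ¬ Even (G.dist u w + 1) := fun h' => Nat.even_add_one.1 h' hw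
        rw [if_neg hw', if_pos hw]; decide
      · have hw' : Even (G.dist u w + 1) := Nat.even_add_one.2 hw
        rw [if_pos hw', if_neg hw]; decide
    · rw [h]
      by_cases hv : Even (G.dist u v)
      · have hv' : ¬ Even (G.dist u v + 1) := fun h' => Nat.even_add_one.1 h' hv
        rw [if_neg hv', if_pos hv]; decide
      · have hv' : Even (G.dist u v + 1) := Nat.even_add_one.2 hv
        rw [if_pos hv', if_neg hv]; decide
  have hdeg' : ∀ v, α v ≠ v → G.degree v = (fun _ : Fin 2 => q) (c v) + 1 := fun v hv => hdeg v hv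
  -- split both shells by type
  have split : ∀ n : ℕ, {x | G.dist x (α x) = 2 * n}.ncard =
      {x | G.dist x (α x) = 2 * n ∧ c x = 0}.ncard + {x | G.dist x (α x) = 2 * n ∧ c x = 1}.ncard := fun n =>
    ncard_eq_ncard_add_ncard_of_fin_two (TreeDisplacement.finite_setOf_dist_self_apply_eq hT α hu hfin n) c
  have h01 : (0 : Fin 2) ≠ 1 := by decide
  rw [split k]
  have s1 := split 1
  rw [mul_one] at s1
  rw [s1]
  rcases Nat.even_or_odd' k with ⟨m, rfl | rfl⟩
  · -- `k = 2m`, `m = m' + 1`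
    obtain ⟨m', rfl⟩ := Nat.exists_eq_add_of_le' (show 1 ≤ m by omega)
    have e : 2 * (2 * (m' + 1)) = 2 * (2 * m' + 2) := by ring
    rw [e, ncard_displaced_inter_type_eq_of_even hT α hu hfin c hc (fun _ : Fin 2 => q) hdeg' h01 m',
      ncard_displaced_inter_type_eq_of_even hT α hu hfin c hc (fun _ : Fin 2 => q) hdeg' h01.symm m',
      show 2 * (m' + 1) - 1 = 2 * m' + 1 by omega, pow_succ, pow_mul, sq]
    ring
  · -- `k = 2m + 1`
    rw [ncard_displaced_inter_type_eq_of_odd hT α hu hfin c hc (fun _ : Fin 2 => q) hdeg' h01 m,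
      ncard_displaced_inter_type_eq_of_odd hT α hu hfin c hc (fun _ : Fin 2 => q) hdeg' h01.symm m,
      show 2 * m + 1 - 1 = 2 * m by omega, pow_mul, sq]
    ring

/-- **REGULAR TREES, FROM THE BOUNDARY OF `Fix α`**: `#{x | d(x, αx) = 2k} = q^{k−1} · Σ_{y ∈ Fix α} #{w ∈ N(y) | αw ≠ w}` (`k ≥ 1`; §3 + §1) — for `Fix α = {x₀}` the classical
`(q+1)·q^{k−1}`. [cite: Serre1980Trees, I.2.3 Ex. 2, I.6.4 Prop. 24] -/
theorem ncard_displaced_eq_of_regular_sum [DecidableEq V] [G.LocallyFinite] (hT : G.IsTree) (α : G ≃g G) {u : V} (hu : α u = u) (hfin : {v | α v = v}.Finite)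
    (q : ℕ) (hdeg : ∀ v, α v ≠ v → G.degree v = q + 1) {k : ℕ} (hk : 1 ≤ k) :
    {x | G.dist x (α x) = 2 * k}.ncard = q ^ (k - 1) * ∑ y ∈ hfin.toFinset, ((G.neighborFinset y).filter (fun w => α w ≠ w)).card := by
  rw [ncard_displaced_eq_of_regular hT α hu hfin q hdeg hk, ncard_displaced_two_eq_sum hT α hu hfin]

end Summit.HodgeConjecture.HodgeConjecture.R90.S6
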